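import Summits.Ventures.GridStability.Models.NE39SplitLurieLines
import Summits.Ventures.GridStability.Lyapunov.K2ALossySplitLinesCast
import HarnessLib

/-!
# GridStability/Lyapunov/NE39LossySplitLinesCast — the UNORDERED-LINES split object `NE39.splitLurieLinesSystem`
# (model-4's lossy 39-bus 10-machine Kron model `NE39.preLossless.toModelRel (1/10) 0`) as casts of rational matrices,
# and `C·B = 0` («NE39-LOSSY-SPLITU», object file)

Cell `gridfusion` (LADDER-GRIDFUSION G2.c lossy Lur'e tier, 39-bus rung); seat gridfusion-lit-6 (g10).  The NE39 twin of
`K2ALossySplitLinesCast` (p581845): index flattening `e1 : Fin 10 ⊕ Fin 9 ≃ Fin 19` (`ω₀ … ω₉, σ₁ … σ₉`); the object's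
matrices over `ℚ` — `MinvQ` (`1/M_i`, the record's rational inertias), `AQ` (`−1/10` on the speed diagonal = the declared
uniform damping ratio `λ = D_i/M_i`, `refT`), `lineInputQ` / `BLQ = [lineInputQ; 0]` (sine line `(p,q)`, `p < q`: `+K^B_pq/M_p`
in row `p`, `−K^B_qp/M_q` in row `q`; cosine line `+K^G_pq/M_p`, `+K^G_qp/M_q`; columns `p ≥ q` zero), `pairIncQ`,
`CQ = [0 | pairIncidence; pairIncidence]` (channel `(p,q)` of either family reads `σ_p − σ_q`, `σ_0 := 0`) — and the identities
`A_eq / B_eq / C_eq` with `S = NE39.splitLurieLinesSystem` (`Models/NE39SplitLurieLines.lean`, p585411), plus `C_mul_B`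
(`S.C * S.B = 0`: the machine-reference structure, lit-6's `System.machineReference_C_mul_B`) — the hypothesis of lit-6's
Schur-form constructor `LPSlabCertificate.ofSchur` (p585320).  Channel-indexed literals of the certificate files are
TABLES `Fin 2 → Fin 10 → Fin 10 → …` (family, `p`, `q`) read through `Sum.elim` — no flattening of the 200 channels.
THREE COLUMNS.  CERTIFIED: nothing (identities).  MODELLED: as `Models/NE39SplitLurieLines` / model-4's NE39 lossy Kron
record (`NE39.preLossless`: transfer conductances KEPT, ASSUMED uniform damping `λ = 1/10`, `a′ = 0`).  VALIDATED: nothing.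
No sentence of this file says a grid is stable.
[cite: Pai1981, §3.6.3 eqs. (3.43)–(3.45), §4.6 p. 117; VuTuritsyn2017, §4.1]
-/

noncomputable section

open Real Matrix
open Literature.MathematicalPhysics.PowerSystems
open Literature.MathematicalPhysics.PowerSystems.LyapunovFunctionFamily
open Summit.Ventures.GridStability.Models

namespace Summit.Ventures.GridStability.Lyapunov.NE39LossySplitLines

/-! ### Index flattening (states only) -/

/-- States `Fin 10 ⊕ Fin 9 ≃ Fin 19` (`ω₀ … ω₉, σ₁ … σ₉`). -/
def e1 : Fin 10 ⊕ Fin 9 ≃ Fin 19 := finSumFinEquiv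

/-! ### The object's matrices over `ℚ` -/

/-- `1/M_i` over `ℚ` (the record's rational inertias). -/
def MinvQ (i : Fin 10) : ℚ := 1 / NE39.preLossless.M i

/-- `A = [[−diag(λ), 0], [refT, 0]]` over `ℚ`, `λ = 1/10`. -/
def AQ : Matrix (Fin 10 ⊕ Fin 9) (Fin 10 ⊕ Fin 9) ℚ :=
  Matrix.fromBlocks (-Matrix.diagonal (fun _ => (1 : ℚ) / 10)) 0
    (Matrix.of fun a i => (if i = a.succ then 1 else 0) - (if i = 0 then 1 else 0)) 0

/-- `lineInput` over `ℚ`: sine line `(p,q)`, `p < q`: `+C_pq/M_p` in row `p`, `−C_qp/M_q` in row `q`; cosine line: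
`+D_pq/M_p` and `+D_qp/M_q`; columns with `p ≥ q` zero (lit-6's definition verbatim over `ℚ`). -/
def lineInputQ : Matrix (Fin 10) ((Fin 10 × Fin 10) ⊕ (Fin 10 × Fin 10)) ℚ :=
  Matrix.of fun i k =>
    Sum.elim
      (fun k : Fin 10 × Fin 10 =>
        (if k.1 = i then (if k.1 < k.2 then NE39.preLossless.Cc k.1 k.2 * MinvQ i else 0) else 0)
          - (if k.2 = i then (if k.1 < k.2 then NE39.preLossless.Cc k.2 k.1 * MinvQ i else 0) else 0))
      (fun k : Fin 10 × Fin 10 =>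
        (if k.1 = i then (if k.1 < k.2 then NE39.preLossless.Dc k.1 k.2 * MinvQ i else 0) else 0)
          + (if k.2 = i then (if k.1 < k.2 then NE39.preLossless.Dc k.2 k.1 * MinvQ i else 0) else 0))
      k

/-- `B = [lineInput; 0]` over `ℚ`. -/
def BLQ : Matrix (Fin 10 ⊕ Fin 9) ((Fin 10 × Fin 10) ⊕ (Fin 10 × Fin 10)) ℚ := Matrix.fromRows lineInputQ 0

/-- The ordered-pair incidence over `ℚ`. -/
def pairIncQ : Matrix (Fin 10 × Fin 10) (Fin 9) ℚ :=
  Matrix.of fun k a => (if k.1 = a.succ then 1 else 0) - (if k.2 = a.succ then 1 else 0)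

/-- `C = [0 | pairIncidence; pairIncidence]` over `ℚ`. -/
def CQ : Matrix ((Fin 10 × Fin 10) ⊕ (Fin 10 × Fin 10)) (Fin 10 ⊕ Fin 9) ℚ := Matrix.fromCols 0 (Matrix.fromRows pairIncQ pairIncQ)

/-! ### The object `NE39.splitLurieLinesSystem`: its matrices are the casts -/

/-- `toLitNode.M = M` (cast). -/
private theorem tM' (i : Fin 10) : (NE39.preLossless.toModelRel (1 / 10) 0).toLitNode.M i = ((NE39.preLossless.M i : ℚ) : ℝ) := by
  rw [ClassicalSwing.toLitNode_M]; rfl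

/-- `M_i ≠ 0` (real). -/
private theorem tM_ne (i : Fin 10) : ((NE39.preLossless.M i : ℚ) : ℝ) ≠ 0 := by
  exact_mod_cast NE39.preLossless_M_ne_zero i

/-- `toLitNode.D = (1/10)·M` (the declared uniform damping). -/
private theorem tD' (i : Fin 10) : (NE39.preLossless.toModelRel (1 / 10) 0).toLitNode.D i = ((1 / 10 : ℚ) : ℝ) * ((NE39.preLossless.M i : ℚ) : ℝ) := rfl

/-- `D_i/M_i = 1/10` on the litnode of the uniform-damping reading (plumbing). -/
private theorem tDM' (i : Fin 10) :
    (NE39.preLossless.toModelRel (1 / 10) 0).toLitNode.D i / (NE39.preLossless.toModelRel (1 / 10) 0).toLitNode.M i = (((1 : ℚ) / 10 : ℚ) : ℝ) := by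
  rw [tD', tM', mul_div_assoc, div_self (tM_ne i), mul_one]

/-- `toLitNode.C p q = (Cc p q : ℝ)` — the sine weights are the typed rationals `E_pE_qB_pq`. -/
private theorem tC' (p q : Fin 10) :
    (NE39.preLossless.toModelRel (1 / 10) 0).toLitNode.C p q = ((NE39.preLossless.Cc p q : ℚ) : ℝ) := by
  simp only [InternalNode.C, RecastData.Cc, Rat.cast_mul]; rfl

/-- `toLitNode.Dtr p q = (Dc p q : ℝ)` — the cosine weights are the typed rationals `E_pE_qG_pq`. -/
private theorem tDtr' (p q : Fin 10) :
    (NE39.preLossless.toModelRel (1 / 10) 0).toLitNode.Dtr p q = ((NE39.preLossless.Dc p q : ℚ) : ℝ) := by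
  simp only [InternalNode.Dtr, RecastData.Dc, Rat.cast_mul]; rfl

/-- `S.A = AQ ↦ ℝ`. -/
theorem A_eq : NE39.splitLurieLinesSystem.A = AQ.map (Rat.cast : ℚ → ℝ) := by
  rw [NE39.splitLurieLinesSystem_A]
  ext a b
  rcases a with i | m <;> rcases b with i' | m'
  · by_cases h : i = i'
    · subst h
      simp only [Matrix.fromBlocks_apply₁₁, Matrix.neg_apply, Matrix.diagonal_apply_eq, AQ, Matrix.map_apply, tDM']
      push_cast; norm_num
    · simp [Matrix.fromBlocks, AQ, Matrix.diagonal, h]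
  · simp [Matrix.fromBlocks, AQ]
  · simp only [Matrix.fromBlocks_apply₂₁, InternalNode.refT, Matrix.of_apply, AQ, Matrix.map_apply]
    split_ifs <;> norm_num
  · simp [Matrix.fromBlocks, AQ]

/-- `lineInput` of the instance is the cast of `lineInputQ`. -/
theorem lineInput_eq : (NE39.preLossless.toModelRel (1 / 10) 0).toLitNode.lineInput = lineInputQ.map (Rat.cast : ℚ → ℝ) := by
  ext i k
  have hdiv : ∀ x : ℝ, x / (NE39.preLossless.toModelRel (1 / 10) 0).toLitNode.M i = x * ((MinvQ i : ℚ) : ℝ) := by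
    intro x; rw [tM', MinvQ]; push_cast; rw [div_eq_mul_one_div]
  rcases k with ⟨p, q⟩ | ⟨p, q⟩ <;>
    simp only [InternalNode.lineInput, lineInputQ, Matrix.of_apply, Sum.elim_inl, Sum.elim_inr,
      Matrix.map_apply, tC', tDtr', hdiv] <;> split_ifs <;> push_cast <;> ring

/-- `S.B = BLQ ↦ ℝ` (RATIONAL). -/
theorem B_eq : NE39.splitLurieLinesSystem.B = BLQ.map (Rat.cast : ℚ → ℝ) := by
  rw [NE39.splitLurieLinesSystem_B, lineInput_eq]
  ext a k
  rcases a with i | m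
  · simp [BLQ]
  · simp [BLQ]

/-- `S.C = CQ ↦ ℝ`. -/
theorem C_eq : NE39.splitLurieLinesSystem.C = CQ.map (Rat.cast : ℚ → ℝ) := by
  rw [NE39.splitLurieLinesSystem_C]
  ext k b
  rcases b with i | m
  · rcases k with k | k <;> simp [CQ]
  · rcases k with k | k <;>
      simp only [Matrix.fromCols_apply_inr, Matrix.fromRows_apply_inl, Matrix.fromRows_apply_inr,
        InternalNode.pairIncidence, Matrix.of_apply, CQ, pairIncQ, Matrix.map_apply] <;>
      split_ifs <;> norm_num

/-- **`C·B = 0`** on the split presentation (machine-reference structure: `C = [0 | E]`, `B = [B_ω; 0]`) — the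
hypothesis of lit-6's Schur-form constructor `LPSlabCertificate.ofSchur`. -/
theorem C_mul_B : NE39.splitLurieLinesSystem.C * NE39.splitLurieLinesSystem.B = 0 := by
  rw [show NE39.splitLurieLinesSystem = System.machineReference _ _ _ _ _ from rfl]
  exact System.machineReference_C_mul_B _ _ _ _ _

end Summit.Ventures.GridStability.Lyapunov.NE39LossySplitLines

end
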